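import Summits.ValiantsHypothesis.ValiantsHypothesis.Theorems.LacunarySymmetroidMatrixDescartesCensusTetranomialWindow

/-!
# `MatrixDescartes` census — the T4 ROW of a Descartes-sharp fewnomial at a window of four consecutive monomials (Newton product form)

HONEST FRAMING.  Object-search cell `pub-symmetroid`; door-A item `Theses.LacunarySymmetroid.DoorA26 = PosRootLawAt 2 6 19`
(stmt-ValiantsHypothesis-19979; OPEN, typed, never asserted).  Third T4 file (after `…CensusTetranomialStaircase`, `…CensusTetranomialWindow`):
the composition that a census node file consumes, exactly parallel to the C25 row `Census.newton_cone`: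

* `newton_T4_row` — let `f = ∑_{t<n} cₜ X^{eₜ}` (`e` strictly increasing) have `≥ n − 1` distinct positive roots, let `p < q < r < s` be
  CONSECUTIVE indices (no index strictly between `p` and `s` other than `q, r`) with alternating coefficients
  (`c_p c_q < 0`, `c_q c_r < 0`, `c_r c_s < 0`), put `Aₜ := |cₜ| · ∏_{u ∉ {p,q,r,s}} |eₜ − e_u|` and `a = e_q − e_p`, `b = e_r − e_p`,
  `c = e_s − e_p`.  If `(β′, γ′, ξ)` is a rational upper-branch double-root point of the normalised tetranomial family (three polynomial
  conditions) and `A_r^c ≤ γ′^c · A_p^{c−b} · A_s^b`, then `A_q^c ≤ β′^c · A_p^{c−a} · A_s^a`.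

Proof: `tetranomial_window_card` gives the four-term window `∑ cₜ ∏(eₜ − e_u) X^{eₜ}` three positive roots; for a consecutive window every
outside index lies below `p` or above `s`, so the gap products have a COMMON sign `ε = ∏ σ_u` and the window is `± (A_p X^{e_p} − A_q X^{e_q} +
A_r X^{e_r} − A_s X^{e_s})`; then `tetranomial_upper_staircase_coeff`.  The other branch / mirror rows are the same statement for the
reversed window (`tetranomial_reverse_card`).  Nothing here bears on `DoorA26`, on `MatrixDescartes` (18050) or on `VP ≠ VNP`.

[folklore] Bookkeeping over the two previous files; elementary.
-/

-- `Summit.ValiantsHypothesis.ValiantsHypothesis.…` repeats a component by the D-0017 layout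
-- (single-conjunct summit), which the `dupNamespace` linter flags; the name is mandated.
set_option linter.dupNamespace false

namespace Summit.ValiantsHypothesis.ValiantsHypothesis.Theorems.LacunarySymmetroidMatrixDescartes.Census.T4

open Polynomial Finset
open scoped BigOperators Polynomial
open Summit.ValiantsHypothesis.ValiantsHypothesis.Theorems.LacunarySymmetroidMatrixDescartes.Census

/-- **THE T4 ROW (Newton product form) at a window of four consecutive monomials.** See the module docstring. [this work] -/
theorem newton_T4_row {n : ℕ} (e : Fin n → ℕ) (he : StrictMono e) (c : Fin n → ℝ)
    (hZ : n ≤ ((∑ t, C (c t) * X ^ (e t)).roots.toFinset.filter (fun x => 0 < x)).card + 1)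
    {p q r s : Fin n} (hpq : p < q) (hqr : q < r) (hrs : r < s)
    (hcons : ∀ u : Fin n, p < u → u < s → u = q ∨ u = r)
    (h1 : c p * c q < 0) (h2 : c q * c r < 0) (h3 : c r * c s < 0)
    (β' γ' ξ : ℝ) (hξ : 0 < ξ)
    (hD₁ : (C 1 - C β' * X ^ (e q - e p) + C γ' * X ^ (e r - e p) - X ^ (e s - e p) : ℝ[X]).eval ξ = 0)
    (hD₂ : (C (-((e q - e p : ℕ) : ℝ)) + C ((((e r - e p : ℕ) : ℝ) - ((e q - e p : ℕ) : ℝ)) * γ') * X ^ (e r - e p)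
              - C (((e s - e p : ℕ) : ℝ) - ((e q - e p : ℕ) : ℝ)) * X ^ (e s - e p) : ℝ[X]).eval ξ = 0)
    (hD₃ : ((e r - e p : ℕ) : ℝ) * (((e r - e p : ℕ) : ℝ) - ((e q - e p : ℕ) : ℝ)) * γ' * ξ ^ (e r - e p)
              ≤ ((e s - e p : ℕ) : ℝ) * (((e s - e p : ℕ) : ℝ) - ((e q - e p : ℕ) : ℝ)) * ξ ^ (e s - e p))
    (hγ : (|c r| * ∏ u ∈ (((univ.erase p).erase q).erase r).erase s, |(e r : ℝ) - e u|) ^ (e s - e p)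
        ≤ γ' ^ (e s - e p) * (|c p| * ∏ u ∈ (((univ.erase p).erase q).erase r).erase s, |(e p : ℝ) - e u|) ^ ((e s - e p) - (e r - e p))
          * (|c s| * ∏ u ∈ (((univ.erase p).erase q).erase r).erase s, |(e s : ℝ) - e u|) ^ (e r - e p)) :
    (|c q| * ∏ u ∈ (((univ.erase p).erase q).erase r).erase s, |(e q : ℝ) - e u|) ^ (e s - e p)
      ≤ β' ^ (e s - e p) * (|c p| * ∏ u ∈ (((univ.erase p).erase q).erase r).erase s, |(e p : ℝ) - e u|) ^ ((e s - e p) - (e q - e p))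
        * (|c s| * ∏ u ∈ (((univ.erase p).erase q).erase r).erase s, |(e s : ℝ) - e u|) ^ (e q - e p) := by
  classical
  set U : Finset (Fin n) := (((univ.erase p).erase q).erase r).erase s with hU
  have hmemU : ∀ t, t ∈ U ↔ (t ≠ p ∧ t ≠ q ∧ t ≠ r ∧ t ≠ s) := by
    intro t; simp only [hU, Finset.mem_erase, Finset.mem_univ, and_true]; tauto
  -- exponent gaps
  have hepq : e p < e q := he hpq
  have heqr : e q < e r := he hqr
  have hers : e r < e s := he hrs
  set a := e q - e p with ha
  set b := e r - e p with hb
  set cc := e s - e p with hcc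
  have ha0 : 0 < a := by omega
  have hab : a < b := by omega
  have hbc : b < cc := by omega
  have eq_q : e q = e p + a := by omega
  have eq_r : e r = e p + b := by omega
  have eq_s : e s = e p + cc := by omega
  -- outside indices are below p or above s
  have hout : ∀ u ∈ U, u < p ∨ s < u := by
    intro u hu
    obtain ⟨hup, huq, hur, hus⟩ := (hmemU u).mp hu
    rcases lt_or_gt_of_ne hup with h | h
    · exact Or.inl h
    · rcases lt_or_gt_of_ne hus with h' | h'
      · rcases hcons u h h' with h'' | h''
        · exact absurd h'' huq
        · exact absurd h'' hur
      · exact Or.inr h'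
  -- common sign of the gap products on the window
  let σ : Fin n → ℝ := fun u => if u < p then 1 else -1
  have hsign : ∀ t ∈ ({p, q, r, s} : Finset (Fin n)), ∀ u ∈ U, ((e t : ℝ) - e u) = σ u * |(e t : ℝ) - e u| := by
    intro t ht u hu
    have htp : p ≤ t := by
      simp only [Finset.mem_insert, Finset.mem_singleton] at ht
      rcases ht with rfl | rfl | rfl | rfl
      · exact le_rfl
      · exact hpq.le
      · exact (hpq.trans hqr).le
      · exact (hpq.trans (hqr.trans hrs)).le
    have hts : t ≤ s := by
      simp only [Finset.mem_insert, Finset.mem_singleton] at ht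
      rcases ht with rfl | rfl | rfl | rfl
      · exact (hpq.trans (hqr.trans hrs)).le
      · exact (hqr.trans hrs).le
      · exact hrs.le
      · exact le_rfl
    rcases hout u hu with h | h
    · have : e u < e t := he (lt_of_lt_of_le h htp)
      have hpos : (0 : ℝ) < (e t : ℝ) - e u := by
        have : (e u : ℝ) < e t := by exact_mod_cast this
        linarith
      simp only [σ, if_pos h, one_mul, abs_of_pos hpos]
    · have : e t < e u := he (lt_of_le_of_lt hts h)
      have hneg : (e t : ℝ) - e u < 0 := by
        have : (e t : ℝ) < e u := by exact_mod_cast this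
        linarith
      have hnp : ¬ u < p := not_lt.mpr ((hpq.trans (hqr.trans hrs)).le.trans h.le)
      simp only [σ, if_neg hnp, abs_of_neg hneg]; ring
  set ε : ℝ := ∏ u ∈ U, σ u with hε
  have hε2 : ε = 1 ∨ ε = -1 := by
    rw [hε]
    refine Finset.prod_induction _ (fun x => x = 1 ∨ x = -1) ?_ (Or.inl rfl) ?_
    · rintro x y (rfl | rfl) (rfl | rfl) <;> norm_num
    · intro u _; by_cases h : u < p <;> simp [σ, h]
  have hprod : ∀ t ∈ ({p, q, r, s} : Finset (Fin n)),
      ∏ u ∈ U, ((e t : ℝ) - e u) = ε * ∏ u ∈ U, |(e t : ℝ) - e u| := by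
    intro t ht
    rw [Finset.prod_congr rfl (fun u hu => hsign t ht u hu), Finset.prod_mul_distrib]
  have mp : p ∈ ({p, q, r, s} : Finset (Fin n)) := by simp
  have mq : q ∈ ({p, q, r, s} : Finset (Fin n)) := by simp
  have mr : r ∈ ({p, q, r, s} : Finset (Fin n)) := by simp
  have ms : s ∈ ({p, q, r, s} : Finset (Fin n)) := by simp
  -- the four coefficients' signs: η := sign of c p
  have hcp : c p ≠ 0 := fun h => by rw [h, zero_mul] at h1; exact lt_irrefl _ h1
  -- positivity of the A's
  set Pp := ∏ u ∈ U, |(e p : ℝ) - e u| with hPp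
  set Pq := ∏ u ∈ U, |(e q : ℝ) - e u| with hPq
  set Pr := ∏ u ∈ U, |(e r : ℝ) - e u| with hPr
  set Ps := ∏ u ∈ U, |(e s : ℝ) - e u| with hPs
  have hPpos : ∀ t, t ∈ ({p, q, r, s} : Finset (Fin n)) → 0 < ∏ u ∈ U, |(e t : ℝ) - e u| := by
    intro t ht
    refine Finset.prod_pos fun u hu => abs_pos.mpr (sub_ne_zero.mpr ?_)
    have hut : u ≠ t := by
      obtain ⟨hup, huq, hur, hus⟩ := (hmemU u).mp hu
      simp only [Finset.mem_insert, Finset.mem_singleton] at ht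
      rcases ht with rfl | rfl | rfl | rfl <;> assumption
    exact_mod_cast fun h => hut (he.injective h).symm
  -- the window polynomial from `tetranomial_window_card`
  have hW := tetranomial_window_card e c hZ hpq hqr hrs
  rw [hprod p mp, hprod q mq, hprod r mr, hprod s ms] at hW
  -- rewrite it as ± (A_p X^{e_p} − A_q X^{e_q} + A_r X^{e_r} − A_s X^{e_s})
  -- case on the sign of c p; the alternation fixes the others
  have key : ∀ (η : ℝ), (η = 1 ∨ η = -1) → c p = η * |c p| → c q = -(η * |c q|) ∧ c r = η * |c r| ∧ c s = -(η * |c s|) := by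
    intro η hη hp'
    have hcq : c q ≠ 0 := fun h => by rw [h, mul_zero] at h1; exact lt_irrefl _ h1
    have hcr : c r ≠ 0 := fun h => by rw [h, mul_zero] at h2; exact lt_irrefl _ h2
    rcases hη with rfl | rfl
    · have hp0 : 0 < c p := by rw [hp']; simpa using abs_pos.mpr hcp
      have hq0 : c q < 0 := by nlinarith
      have hr0 : 0 < c r := by nlinarith
      have hs0 : c s < 0 := by nlinarith
      refine ⟨?_, ?_, ?_⟩
      · rw [one_mul, abs_of_neg hq0]; ring
      · rw [one_mul, abs_of_pos hr0]
      · rw [one_mul, abs_of_neg hs0]; ring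
    · have hp0 : c p < 0 := by
        rw [hp']; have := abs_pos.mpr hcp; linarith
      have hq0 : 0 < c q := by nlinarith
      have hr0 : c r < 0 := by nlinarith
      have hs0 : 0 < c s := by nlinarith
      refine ⟨?_, ?_, ?_⟩
      · rw [abs_of_pos hq0]; ring
      · rw [abs_of_neg hr0]; ring
      · rw [abs_of_pos hs0]; ring
  obtain ⟨η, hη, hp'⟩ : ∃ η : ℝ, (η = 1 ∨ η = -1) ∧ c p = η * |c p| := by
    rcases lt_or_gt_of_ne hcp with h | h
    · exact ⟨-1, Or.inr rfl, by rw [abs_of_neg h]; ring⟩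
    · exact ⟨1, Or.inl rfl, by rw [abs_of_pos h, one_mul]⟩
  obtain ⟨hq', hr', hs'⟩ := key η hη hp'
  set D : ℝ[X] := C (|c p| * Pp) * X ^ (e p) - C (|c q| * Pq) * X ^ (e p + a)
      + C (|c r| * Pr) * X ^ (e p + b) - C (|c s| * Ps) * X ^ (e p + cc) with hDdef
  -- |c t| in terms of c t (η = ±1)
  have hη2 : η * η = 1 := by rcases hη with rfl | rfl <;> norm_num
  have e1 : |c p| = η * c p := by
    have : η * c p = η * (η * |c p|) := by rw [← hp']
    rw [← mul_assoc, hη2, one_mul] at this; exact this.symm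
  have e2 : |c q| = -(η * c q) := by
    have : η * c q = η * (-(η * |c q|)) := by rw [← hq']
    rw [mul_neg, ← mul_assoc, hη2, one_mul] at this; linarith
  have e3 : |c r| = η * c r := by
    have : η * c r = η * (η * |c r|) := by rw [← hr']
    rw [← mul_assoc, hη2, one_mul] at this; exact this.symm
  have e4 : |c s| = -(η * c s) := by
    have : η * c s = η * (-(η * |c s|)) := by rw [← hs']
    rw [mul_neg, ← mul_assoc, hη2, one_mul] at this; linarith
  have hWD : (C (c p * (ε * Pp)) * X ^ e p + C (c q * (ε * Pq)) * X ^ e q + C (c r * (ε * Pr)) * X ^ e r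
      + C (c s * (ε * Ps)) * X ^ e s) = C (ε * η) * D := by
    rw [hDdef, e1, e2, e3, e4, eq_q, eq_r, eq_s]
    rcases hη with rfl | rfl
    · simp only [map_mul, map_neg, one_mul, mul_one]
      ring
    · simp only [map_mul, map_neg, map_one]
      ring
  have hεη : ε * η = 1 ∨ ε * η = -1 := by
    rcases hε2 with h | h <;> rcases hη with h' | h' <;> simp [h, h']
  have hZD : 3 ≤ (D.roots.toFinset.filter (fun x => 0 < x)).card := by
    rw [hWD] at hW
    rcases hεη with h | h
    · rw [h, map_one, one_mul] at hW; exact hW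
    · rw [h, map_neg, map_one, neg_one_mul, roots_neg] at hW; exact hW
  -- apply the product-form staircase
  have hApos : 0 < |c p| * Pp := mul_pos (abs_pos.mpr hcp) (hPpos p mp)
  have hAq : 0 < |c q| * Pq := mul_pos (abs_pos.mpr (fun h => by rw [h, mul_zero] at h1; exact lt_irrefl _ h1)) (hPpos q mq)
  have hAr : 0 < |c r| * Pr := mul_pos (abs_pos.mpr (fun h => by rw [h, mul_zero] at h2; exact lt_irrefl _ h2)) (hPpos r mr)
  have hAs : 0 < |c s| * Ps := mul_pos (abs_pos.mpr (fun h => by rw [h, mul_zero] at h3; exact lt_irrefl _ h3)) (hPpos s ms)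
  exact tetranomial_upper_staircase_coeff ha0 hab hbc _ _ _ _ hApos hAq hAr hAs (e p) hZD β' γ' ξ hξ hD₁ hD₂ hD₃ hγ

end Summit.ValiantsHypothesis.ValiantsHypothesis.Theorems.LacunarySymmetroidMatrixDescartes.Census.T4
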